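import Literature.Analysis.FluidPDE.NSGalerkinFamilyEnergy
import Literature.Analysis.FluidPDE.NSHopfWeakConvergence
import HarnessLib

/-!
# Navier–Stokes on `T^d`: the weak form for the limit of a Hopf–Galerkin **family** and the
  Leray–Hopf property of the limit (part 3 of the family pipeline)

Trunk: FluidKinetic. Port of `NSHopfGalerkinLimit` (Robinson–Rodrigo–Sadowski 2016, Thm. 4.4
Step 4, pp. 76–77, Thm. 4.6, Cor. 4.7, Thm. 4.11 and the remark on abstract sequences, p. 82;
Constantin–Foias 1988, Ch. 8, (8.5) and Theorem (Leray); Hopf 1951, §4) from Hopf–Galerkin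
schemes to Hopf–Galerkin **families** `NS.IsHopfGalerkinFamily ν f u₀ N F U`
(`NSGalerkinFamilyLimit`, `NSGalerkinFamilyEnergy`). The differences with the scheme version are
confined to the datum: the Galerkin identities integrated by parts in time now carry the boundary
term `∫ ⟪U n 0, a⟫` (there is no `initial_inner` to convert it into `∫ ⟪u₀, a⟫`), the weak-form
functional of the approximations is `E_n(ψ) = ∫₀ᵀ Φ(U n, F n) + ∫ ⟪U n 0, ψ(0)⟫`, and in the limit
`∫ ⟪U n 0, ψ(0)⟫ → ∫ ⟪u 0, ψ(0)⟫` by the weak `L²` convergence of the slices at time `0`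
(`IsHopfGalerkinFamily.tendsto_integral_inner_limit`, the port of RRS (4.12) from
`NSHopfWeakConvergence`). The main result `IsHopfGalerkinFamily.isLerayHopfOn_limit`: a
coefficientwise limit `u` of a Hopf–Galerkin family with `ν > 0` whose data converge strongly,
`‖U n 0 - u 0‖_{L²} → 0`, is a Leray–Hopf weak solution on every `[0, T)` from the datum `u 0`.

Generic tools (transversal frames, slice functionals, truncation errors) are imported from
`NSHopfGalerkinLimit`. Theorem-only file.

## References

* E. Hopf, Math. Nachr. 4 (1951), 213–231, §4.
* J. C. Robinson, J. L. Rodrigo, W. Sadowski, *The three-dimensional Navier–Stokes equations*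
  (CUP 2016), Def. 3.3, Lemma 4.1, Thm. 4.4 Step 4 (pp. 76–77), (4.5), (4.12), Thm. 4.6, Cor. 4.7,
  Thm. 4.11, p. 82.
* P. Constantin, C. Foias, *Navier–Stokes Equations* (Chicago 1988), Ch. 8, (8.5), pp. 45–48,
  Theorem (Leray).
-/

noncomputable section

open MeasureTheory TopologicalSpace Set Function Filter Topology UnitAddTorus
open scoped InnerProductSpace RealInnerProductSpace ENNReal NNReal

namespace Literature.Analysis.FluidPDE

section NS

variable {d : Type*} [Fintype d] [DecidableEq d]

variable {ν : ℝ} {f : ℝ → UnitAddTorus d → EuclideanSpace ℝ d}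
  {u₀ : UnitAddTorus d → EuclideanSpace ℝ d} {N : ℕ → ℕ}
  {F U : ℕ → ℝ → UnitAddTorus d → EuclideanSpace ℝ d}
  {u : ℝ → UnitAddTorus d → EuclideanSpace ℝ d}

/-! ## Integration by parts in time at the Galerkin level -/

section IBP

/-- The tested Galerkin right-hand side `t ↦ ∫(⟪U n,(U n·∇)a⟫ + ν⟪U n, Δa⟫ + ⟪F n, a⟫)` is
continuous on `[0, ∞)` for a smooth field `a`. [folklore] -/
theorem IsHopfGalerkinFamily.continuousOn_galerkin_rhs (hS : IsHopfGalerkinFamily ν f u₀ N F U)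
    (n : ℕ) {a : UnitAddTorus d → EuclideanSpace ℝ d} (ha : FunctionSpaces.Torus.IsSmooth a) :
    ContinuousOn (fun t => ∫ x, (⟪U n t x, FunctionSpaces.Torus.convect (U n t) a x⟫ +
      ν * ⟪U n t x, FunctionSpaces.Torus.laplacian a x⟫ + ⟪F n t x, a x⟫)) (Set.Ici 0) := by
  -- continuity of the space–time lift of the integrand
  have hU := hS.continuousOn n
  have hF := hS.continuousOn_force n
  have hconv : ContinuousOn (FunctionSpaces.Torus.stLift fun t x => FunctionSpaces.Torus.convect (U n t) a x) (Set.Ici 0 ×ˢ Set.univ) := by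
    have h : (FunctionSpaces.Torus.stLift fun t x => FunctionSpaces.Torus.convect (U n t) a x) =
        fun p => ∑ i, (FunctionSpaces.Torus.stLift (U n) p) i • FunctionSpaces.Torus.partialDeriv i a (FunctionSpaces.Torus.proj p.2) := by
      funext p
      exact FunctionSpaces.Torus.fderiv_apply_eq_sum_partialDeriv (ha.isContDiff (by simp)) _ _
    rw [h]
    refine continuousOn_finsetSum _ fun i _ => ?_
    have hc1 : ContinuousOn (fun p : ℝ × EuclideanSpace ℝ d => (FunctionSpaces.Torus.stLift (U n) p) i)
        (Set.Ici 0 ×ˢ Set.univ) :=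
      (EuclideanSpace.proj (𝕜 := ℝ) i).continuous.comp_continuousOn hU
    have hc2 : ContinuousOn (fun p : ℝ × EuclideanSpace ℝ d => FunctionSpaces.Torus.partialDeriv i a (FunctionSpaces.Torus.proj p.2))
        (Set.Ici 0 ×ˢ Set.univ) :=
      ((ha.partialDeriv i).continuous.comp (FunctionSpaces.Torus.continuous_proj.comp continuous_snd)).continuousOn
    exact hc1.smul hc2
  have hlap : ContinuousOn (FunctionSpaces.Torus.stLift fun (_ : ℝ) x => FunctionSpaces.Torus.laplacian a x) (Set.Ici 0 ×ˢ Set.univ) :=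
    (ha.laplacian.continuous.comp (FunctionSpaces.Torus.continuous_proj.comp continuous_snd)).continuousOn
  have hcst : ContinuousOn (FunctionSpaces.Torus.stLift fun (_ : ℝ) x => a x) (Set.Ici 0 ×ˢ Set.univ) :=
    (ha.continuous.comp (FunctionSpaces.Torus.continuous_proj.comp continuous_snd)).continuousOn
  have h1 := FunctionSpaces.Torus.continuousOn_integral_inner_of_continuousOn_stLift hU hconv
  have h2 := FunctionSpaces.Torus.continuousOn_integral_inner_of_continuousOn_stLift hU hlap
  have h3 := FunctionSpaces.Torus.continuousOn_integral_inner_of_continuousOn_stLift hF hcst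
  have hsum := (h1.add (h2.const_smul ν)).add h3
  refine hsum.congr fun t ht => ?_
  have ht0 : 0 ≤ t := ht
  have hcU : Continuous (U n t) := hS.continuous_slice n ht0
  have hcF : Continuous (F n t) := hS.continuous_force_slice n ht0
  have i1 : Integrable (fun x => ⟪U n t x, FunctionSpaces.Torus.convect (U n t) a x⟫) volume := by
    have h : (fun x => FunctionSpaces.Torus.convect (U n t) a x) =
        fun x => ∑ i, (U n t x) i • FunctionSpaces.Torus.partialDeriv i a x := by
      funext x; exact FunctionSpaces.Torus.fderiv_apply_eq_sum_partialDeriv (ha.isContDiff (by simp)) _ _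
    have hcc : Continuous (fun x => FunctionSpaces.Torus.convect (U n t) a x) := by
      rw [h]
      exact continuous_finsetSum _ fun i _ =>
        (((EuclideanSpace.proj (𝕜 := ℝ) i).continuous.comp hcU).smul (ha.partialDeriv i).continuous)
    exact (hcU.inner hcc).integrable_unitAddTorus
  have i2 : Integrable (fun x => ⟪U n t x, FunctionSpaces.Torus.laplacian a x⟫) volume :=
    (hcU.inner ha.laplacian.continuous).integrable_unitAddTorus
  have i3 : Integrable (fun x => ⟪F n t x, a x⟫) volume := (hcF.inner ha.continuous).integrable_unitAddTorus
  simp only [Pi.add_apply, Pi.smul_apply, smul_eq_mul]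
  have i12 : Integrable (fun x => ⟪U n t x, FunctionSpaces.Torus.convect (U n t) a x⟫ +
      ν * ⟪U n t x, FunctionSpaces.Torus.laplacian a x⟫) volume := i1.add (i2.const_mul ν)
  rw [integral_add i12 i3, integral_add i1 (i2.const_mul ν), integral_const_mul]

/-- The tested Galerkin pairing `t ↦ ∫ ⟪U n t, a⟫` is continuous on `[0, ∞)`. [folklore] -/
theorem IsHopfGalerkinFamily.continuousOn_galerkin_pairing (hS : IsHopfGalerkinFamily ν f u₀ N F U)
    (n : ℕ) {a : UnitAddTorus d → EuclideanSpace ℝ d} (ha : FunctionSpaces.Torus.IsSmooth a) :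
    ContinuousOn (fun t => ∫ x, ⟪U n t x, a x⟫) (Set.Ici 0) :=
  FunctionSpaces.Torus.continuousOn_integral_inner_of_continuousOn_stLift (hS.continuousOn n)
    (ha.continuous.comp (FunctionSpaces.Torus.continuous_proj.comp continuous_snd)).continuousOn

/-- The tested Galerkin pairing has the tested right-hand side as derivative at every `t > 0`
(FTC for the clause `galerkin`, whose right-hand side is continuous). [folklore] -/
theorem IsHopfGalerkinFamily.hasDerivAt_galerkin_pairing (hS : IsHopfGalerkinFamily ν f u₀ N F U)
    (n : ℕ) {a : UnitAddTorus d → EuclideanSpace ℝ d} (ha : IsGalerkinMode (N n) a) {t : ℝ}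
    (ht : 0 < t) :
    HasDerivAt (fun s => ∫ x, ⟪U n s x, a x⟫)
      (∫ x, (⟪U n t x, FunctionSpaces.Torus.convect (U n t) a x⟫ + ν * ⟪U n t x, FunctionSpaces.Torus.laplacian a x⟫ +
        ⟪F n t x, a x⟫)) t := by
  set h : ℝ → ℝ := fun τ => ∫ x, (⟪U n τ x, FunctionSpaces.Torus.convect (U n τ) a x⟫ +
    ν * ⟪U n τ x, FunctionSpaces.Torus.laplacian a x⟫ + ⟪F n τ x, a x⟫) with hh
  have hcont : ContinuousOn h (Set.Ici 0) := hS.continuousOn_galerkin_rhs n ha.isSmooth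
  have hcontI : ContinuousOn h (Set.Ioi 0) := hcont.mono Set.Ioi_subset_Ici_self
  -- the primitive has derivative `h t`
  have hprim : HasDerivAt (fun s => ∫ τ in (0 : ℝ)..s, h τ) (h t) t := by
    refine intervalIntegral.integral_hasDerivAt_right ?_ ?_ ?_
    · exact (hcont.mono Icc_subset_Ici_self).intervalIntegrable_of_Icc ht.le
    · exact hcontI.stronglyMeasurableAtFilter isOpen_Ioi t ht
    · exact hcontI.continuousAt (Ioi_mem_nhds ht)
  -- the pairing agrees with `G 0 + primitive` near `t`
  have heq : (fun s => ∫ x, ⟪U n s x, a x⟫) =ᶠ[𝓝 t]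
      fun s => (∫ x, ⟪U n 0 x, a x⟫) + ∫ τ in (0 : ℝ)..s, h τ := by
    filter_upwards [Ioi_mem_nhds ht] with s hs
    have := hS.galerkin n a ha 0 s le_rfl (le_of_lt hs)
    simp only [hh]
    linarith
  exact (hprim.const_add _).congr_of_eventuallyEq heq

/-- **Integration by parts in time at the Galerkin level** (Robinson–Rodrigo–Sadowski 2016,
Thm. 4.4 Step 4, (4.5) tested against `λ(t) a`, p. 76; Constantin–Foias 1988, (8.5)): for a
Galerkin mode `a` of order `N n`, a scalar `λ` with continuous derivative `λ'` and `λ(T) = 0`,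
`∫₀ᵀ (λ' ⟪U n, a⟫ + λ (⟪U n, (U n·∇)a⟫ + ν⟪U n, Δa⟫ + ⟪F n, a⟫)) dt = -λ(0) ∫⟪U n 0, a⟫` (for a
family the boundary term keeps the datum `U n 0` of the approximation).
[cite: RobinsonRodrigoSadowski2016, Thm. 4.4 Step 4 (4.5)] -/
theorem IsHopfGalerkinFamily.intervalIntegral_mode_ibp (hS : IsHopfGalerkinFamily ν f u₀ N F U)
    (n : ℕ) {a : UnitAddTorus d → EuclideanSpace ℝ d} (ha : IsGalerkinMode (N n) a)
    {lam lam' : ℝ → ℝ} (hlam : ∀ t, HasDerivAt lam (lam' t) t) (hlam' : Continuous lam')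
    {T : ℝ} (hT : 0 < T) (hlamT : lam T = 0) :
    ∫ t in (0 : ℝ)..T, (lam' t * (∫ x, ⟪U n t x, a x⟫) +
        lam t * ∫ x, (⟪U n t x, FunctionSpaces.Torus.convect (U n t) a x⟫ + ν * ⟪U n t x, FunctionSpaces.Torus.laplacian a x⟫ +
          ⟪F n t x, a x⟫)) =
      -(lam 0 * ∫ x, ⟪U n 0 x, a x⟫) := by
  have hG : ContinuousOn (fun t => ∫ x, ⟪U n t x, a x⟫) (Icc 0 T) :=
    (hS.continuousOn_galerkin_pairing n ha.isSmooth).mono Icc_subset_Ici_self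
  have hh : ContinuousOn (fun t => ∫ x, (⟪U n t x, FunctionSpaces.Torus.convect (U n t) a x⟫ +
      ν * ⟪U n t x, FunctionSpaces.Torus.laplacian a x⟫ + ⟪F n t x, a x⟫)) (Icc 0 T) :=
    (hS.continuousOn_galerkin_rhs n ha.isSmooth).mono Icc_subset_Ici_self
  have hlamc : Continuous lam := continuous_iff_continuousAt.2 fun t => (hlam t).continuousAt
  have h := intervalIntegral.integral_eq_sub_of_hasDeriv_right_of_le hT.le
    (f := fun t => lam t * ∫ x, ⟪U n t x, a x⟫)
    (f' := fun t => lam' t * (∫ x, ⟪U n t x, a x⟫) + lam t * ∫ x, (⟪U n t x, FunctionSpaces.Torus.convect (U n t) a x⟫ +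
      ν * ⟪U n t x, FunctionSpaces.Torus.laplacian a x⟫ + ⟪F n t x, a x⟫))
    (hlamc.continuousOn.mul hG) (fun t ht => ?_) ?_
  · rw [h, hlamT, zero_mul, zero_sub]
  · exact ((hlam t).mul (hS.hasDerivAt_galerkin_pairing n ha ht.1)).hasDerivWithinAt
  · exact ((hlam'.continuousOn.mul hG).add (hlamc.continuousOn.mul hh)).intervalIntegrable_of_Icc hT.le

end IBP

/-! ## The Galerkin equations in weak form against truncated test fields -/

section GalerkinWeak

/-- **The Galerkin equations in weak form against truncated test fields**
(Robinson–Rodrigo–Sadowski 2016, Thm. 4.4 Step 4, (4.5) tested against `P_n ψ`, p. 76;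
Constantin–Foias 1988, (8.5), p. 45): for every divergence-free space–time test field `ψ` on
`[0, T)` and every `n`, with `M = N n`,
`∫₀ᵀ ∫ (⟪U n, P_M ∂ₜψ⟫ + ⟪U n, (U n·∇)P_M ψ⟫ + ν⟪U n, Δ P_M ψ⟫ + ⟪F n, P_M ψ⟫) + ∫ ⟪U n 0, P_M ψ(0)⟫ = 0`.
Proof: expand `P_M ψ(t) = ∑ᵢ λᵢ(t) aᵢ` along transversal frames (`fourierTruncate_eq_sum_frame`;
`λᵢ` smooth with `λᵢ' =` coordinates of `𝓕(∂ₜψ t)`, `hasDerivAt_mFourierCoeff_slice`), and sum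
the one-mode identities `intervalIntegral_mode_ibp`. [cite: RobinsonRodrigoSadowski2016, Thm. 4.4 Step 4 (4.5)] -/
theorem IsHopfGalerkinFamily.galerkin_weak_identity (hS : IsHopfGalerkinFamily ν f u₀ N F U)
    (n : ℕ) {T : ℝ} (hT : 0 < T)
    {ψ : ℝ → UnitAddTorus d → EuclideanSpace ℝ d} (hψ : FunctionSpaces.Torus.IsSpaceTimeTest T ψ)
    (hdiv : FunctionSpaces.Torus.IsDivFreeTest ψ) :
    (∫ t in (0 : ℝ)..T, ∫ x,
        (⟪U n t x, FunctionSpaces.Torus.fourierTruncate (N n) (FunctionSpaces.Torus.timeDeriv ψ t) x⟫ +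
          ⟪U n t x, FunctionSpaces.Torus.convect (U n t) (FunctionSpaces.Torus.fourierTruncate (N n) (ψ t)) x⟫ +
          ν * ⟪U n t x, FunctionSpaces.Torus.laplacian (FunctionSpaces.Torus.fourierTruncate (N n) (ψ t)) x⟫ +
          ⟪F n t x, FunctionSpaces.Torus.fourierTruncate (N n) (ψ t) x⟫)) +
      ∫ x, ⟪U n 0 x, FunctionSpaces.Torus.fourierTruncate (N n) (ψ 0) x⟫ = 0 := by
  classical
  -- transversal frames and coordinate functionals
  choose v hvT hv using fun k : d → ℤ => Torus.exists_transversal_frame (d := d) k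
  choose C hC using fun l : d × Bool => Torus.exists_coordCLM (d := d) l
  set I : Finset ((d → ℤ) × (d × Bool)) := FunctionSpaces.Torus.freqBall (N n) ×ˢ Finset.univ with hI
  set a : (d → ℤ) × (d × Bool) → UnitAddTorus d → EuclideanSpace ℝ d :=
    fun i => FunctionSpaces.Torus.realTrigPoly {i.1} (fun _ => v i.1 i.2) with ha
  have ha_mode : ∀ i ∈ I, IsGalerkinMode (N n) (a i) := by
    intro i hi
    exact isGalerkinMode_realTrigPoly_singleton (Finset.mem_product.1 hi).1 (hvT i.1 i.2)
  have ha_smooth : ∀ i, FunctionSpaces.Torus.IsSmooth (a i) := fun i => FunctionSpaces.Torus.isSmooth_realTrigPoly _ _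
  -- coefficients and their derivatives
  set lam : ℝ → (d → ℤ) × (d × Bool) → ℝ :=
    fun t i => C i.2 (mFourierCoeff (FunctionSpaces.EuclideanSpace.complexify ∘ ψ t) i.1) with hlam
  set lam' : ℝ → (d → ℤ) × (d × Bool) → ℝ :=
    fun t i => C i.2 (mFourierCoeff (FunctionSpaces.EuclideanSpace.complexify ∘ FunctionSpaces.Torus.timeDeriv ψ t) i.1) with hlam'
  have hderiv : ∀ i t, HasDerivAt (fun s => lam s i) (lam' t i) t := fun i t =>
    (C i.2).hasFDerivAt.comp_hasDerivAt t
      (FunctionSpaces.Torus.hasDerivAt_mFourierCoeff_slice (hψ.isSmoothSpaceTimeOn Set.univ) i.1 t)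
  have hcont' : ∀ i, Continuous fun t => lam' t i := fun i =>
    (C i.2).continuous.comp (hψ.timeDeriv.continuous_mFourierCoeff i.1)
  have hlamT : ∀ i, lam T i = 0 := by
    intro i
    simp only [hlam, hψ.eq_zero_of_le le_rfl]
    have : mFourierCoeff (FunctionSpaces.EuclideanSpace.complexify ∘ (0 : UnitAddTorus d → EuclideanSpace ℝ d)) i.1 = 0 := by
      simp [mFourierCoeff]
    rw [this, map_zero]
  -- the representations of the truncations
  have hR : ∀ t x, FunctionSpaces.Torus.fourierTruncate (N n) (ψ t) x = ∑ i ∈ I, lam t i • a i x := by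
    intro t x
    rw [Torus.fourierTruncate_eq_sum_frame hv (fun k =>
      FunctionSpaces.Torus.IsDivFree.sum_mul_mFourierCoeff_eq_zero (hψ.isSmooth_slice t) (hdiv t) k)]
    refine Finset.sum_congr rfl fun i _ => ?_
    simp only [hlam, ha, hC]
  have hR' : ∀ t x, FunctionSpaces.Torus.fourierTruncate (N n) (FunctionSpaces.Torus.timeDeriv ψ t) x = ∑ i ∈ I, lam' t i • a i x := by
    intro t x
    rw [Torus.fourierTruncate_eq_sum_frame hv (fun k =>
      hψ.sum_mul_mFourierCoeff_timeDeriv_eq_zero hdiv k t)]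
    refine Finset.sum_congr rfl fun i _ => ?_
    simp only [hlam', ha, hC]
  have hRfun : ∀ t, FunctionSpaces.Torus.fourierTruncate (N n) (ψ t) = fun x => ∑ i ∈ I, lam t i • a i x :=
    fun t => funext (hR t)
  -- the one-mode identities, summed
  have hsum := Finset.sum_congr rfl fun i (hi : i ∈ I) =>
    hS.intervalIntegral_mode_ibp n (ha_mode i hi) (hderiv i) (hcont' i) hT (hlamT i)
  -- continuity facts for interval integrability
  have hG : ∀ i, ContinuousOn (fun t => ∫ x, ⟪U n t x, a i x⟫) (Set.Icc 0 T) := fun i =>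
    (hS.continuousOn_galerkin_pairing n (ha_smooth i)).mono Set.Icc_subset_Ici_self
  have hh : ∀ i, ContinuousOn (fun t => ∫ x, (⟪U n t x, FunctionSpaces.Torus.convect (U n t) (a i) x⟫ +
      ν * ⟪U n t x, FunctionSpaces.Torus.laplacian (a i) x⟫ + ⟪F n t x, a i x⟫)) (Set.Icc 0 T) := fun i =>
    (hS.continuousOn_galerkin_rhs n (ha_smooth i)).mono Set.Icc_subset_Ici_self
  have hlamc : ∀ i, Continuous fun t => lam t i := fun i =>
    continuous_iff_continuousAt.2 fun t => (hderiv i t).continuousAt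
  have hint : ∀ i ∈ I, IntervalIntegrable (fun t => lam' t i * (∫ x, ⟪U n t x, a i x⟫) +
      lam t i * ∫ x, (⟪U n t x, FunctionSpaces.Torus.convect (U n t) (a i) x⟫ +
        ν * ⟪U n t x, FunctionSpaces.Torus.laplacian (a i) x⟫ + ⟪F n t x, a i x⟫)) volume 0 T := fun i _ =>
    (((hcont' i).continuousOn.mul (hG i)).add ((hlamc i).continuousOn.mul (hh i))).intervalIntegrable_of_Icc
      hT.le
  rw [← intervalIntegral.integral_finsetSum hint] at hsum
  -- identify the right-hand side
  have hrhs : ∑ i ∈ I, -(lam 0 i * ∫ x, ⟪U n 0 x, a i x⟫) =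
      -∫ x, ⟪U n 0 x, FunctionSpaces.Torus.fourierTruncate (N n) (ψ 0) x⟫ := by
    rw [Finset.sum_neg_distrib, neg_inj]
    simp_rw [hR 0, inner_sum, inner_smul_right]
    rw [integral_finsetSum I fun i _ =>
      (FunctionSpaces.Torus.integrable_inner_of_continuous (hS.continuous_slice n le_rfl).integrable_unitAddTorus
        (ha_smooth i).continuous).const_mul _]
    exact Finset.sum_congr rfl fun i _ => (integral_const_mul _ _).symm
  -- identify the left-hand side, slice by slice
  have hlhs : ∀ t ∈ Set.Icc 0 T, ∑ i ∈ I, (lam' t i * (∫ x, ⟪U n t x, a i x⟫) +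
      lam t i * ∫ x, (⟪U n t x, FunctionSpaces.Torus.convect (U n t) (a i) x⟫ +
        ν * ⟪U n t x, FunctionSpaces.Torus.laplacian (a i) x⟫ + ⟪F n t x, a i x⟫)) =
      ∫ x, (⟪U n t x, FunctionSpaces.Torus.fourierTruncate (N n) (FunctionSpaces.Torus.timeDeriv ψ t) x⟫ +
        ⟪U n t x, FunctionSpaces.Torus.convect (U n t) (FunctionSpaces.Torus.fourierTruncate (N n) (ψ t)) x⟫ +
        ν * ⟪U n t x, FunctionSpaces.Torus.laplacian (FunctionSpaces.Torus.fourierTruncate (N n) (ψ t)) x⟫ +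
        ⟪F n t x, FunctionSpaces.Torus.fourierTruncate (N n) (ψ t) x⟫) := by
    intro t ht
    have ht0 : 0 ≤ t := ht.1
    have hcU : Continuous (U n t) := hS.continuous_slice n ht0
    have hcF : Continuous (F n t) := hS.continuous_force_slice n ht0
    -- integrability of the mode integrands
    have hconv_cont : ∀ i, Continuous fun x => FunctionSpaces.Torus.convect (U n t) (a i) x := by
      intro i
      have h : (fun x => FunctionSpaces.Torus.convect (U n t) (a i) x) =
          fun x => ∑ j, (U n t x) j • FunctionSpaces.Torus.partialDeriv j (a i) x := by
        funext x; exact FunctionSpaces.Torus.fderiv_apply_eq_sum_partialDeriv ((ha_smooth i).isContDiff (by simp)) _ _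
      rw [h]
      exact continuous_finsetSum _ fun j _ =>
        (((EuclideanSpace.proj (𝕜 := ℝ) j).continuous.comp hcU).smul ((ha_smooth i).partialDeriv j).continuous)
    have iA : ∀ i, Integrable (fun x => ⟪U n t x, a i x⟫) volume := fun i =>
      (hcU.inner (ha_smooth i).continuous).integrable_unitAddTorus
    have iB : ∀ i, Integrable (fun x => ⟪U n t x, FunctionSpaces.Torus.convect (U n t) (a i) x⟫ +
        ν * ⟪U n t x, FunctionSpaces.Torus.laplacian (a i) x⟫ + ⟪F n t x, a i x⟫) volume := fun i =>
      (((hcU.inner (hconv_cont i)).add ((hcU.inner (ha_smooth i).laplacian.continuous).const_smul ν |>.congr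
        (fun x => by simp))).add (hcF.inner (ha_smooth i).continuous)).integrable_unitAddTorus
    -- pull everything inside one integral
    have hstep : ∀ i ∈ I, lam' t i * (∫ x, ⟪U n t x, a i x⟫) +
        lam t i * ∫ x, (⟪U n t x, FunctionSpaces.Torus.convect (U n t) (a i) x⟫ +
          ν * ⟪U n t x, FunctionSpaces.Torus.laplacian (a i) x⟫ + ⟪F n t x, a i x⟫) =
        ∫ x, (lam' t i * ⟪U n t x, a i x⟫ + lam t i * (⟪U n t x, FunctionSpaces.Torus.convect (U n t) (a i) x⟫ +
          ν * ⟪U n t x, FunctionSpaces.Torus.laplacian (a i) x⟫ + ⟪F n t x, a i x⟫)) := by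
      intro i _
      rw [integral_add ((iA i).const_mul _) ((iB i).const_mul _), integral_const_mul, integral_const_mul]
    have iAB : ∀ i ∈ I, Integrable (fun x => lam' t i * ⟪U n t x, a i x⟫ +
        lam t i * (⟪U n t x, FunctionSpaces.Torus.convect (U n t) (a i) x⟫ +
          ν * ⟪U n t x, FunctionSpaces.Torus.laplacian (a i) x⟫ + ⟪F n t x, a i x⟫)) volume := fun i _ =>
      ((iA i).const_mul _).add ((iB i).const_mul _)
    rw [Finset.sum_congr rfl hstep, ← integral_finsetSum I iAB]
    refine integral_congr_ae (ae_of_all _ fun x => ?_)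
    -- pointwise algebra
    dsimp only
    rw [hR' t x, hRfun t, Torus.convect_finset_sum_smul I (lam t) ha_smooth,
      Torus.laplacian_finset_sum_smul I (lam t) ha_smooth]
    simp only [inner_sum, inner_smul_right, Finset.mul_sum, ← Finset.sum_add_distrib]
    refine Finset.sum_congr rfl fun i _ => ?_
    ring
  rw [intervalIntegral.integral_congr (fun t ht => hlhs t (by rwa [Set.uIcc_of_le hT.le] at ht))] at hsum
  rw [hrhs] at hsum
  linarith

end GalerkinWeak

/-! ## The weak-form slice functional: pointwise and integrated estimates -/

section SliceFunctional

end SliceFunctional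

/-! ## Test-field data: continuity and sup bounds on `[0, T] × T^d` -/

section TestData

variable {T : ℝ} {ψ : ℝ → UnitAddTorus d → EuclideanSpace ℝ d}

end TestData

/-! ## Passage to the limit `n → ∞` in the weak-form functional -/

section Limit

variable {T : ℝ} {ψ : ℝ → UnitAddTorus d → EuclideanSpace ℝ d}

/-- **The weak-form slice functional of the approximations is continuous in time** on `[0, ∞)`
(all fields are jointly continuous). [folklore] -/
theorem IsHopfGalerkinFamily.continuousOn_sliceFunctional (hS : IsHopfGalerkinFamily ν f u₀ N F U)
    (hψ : FunctionSpaces.Torus.IsSpaceTimeTest T ψ) (n : ℕ) :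
    ContinuousOn (fun t => ∫ x, (⟪U n t x, FunctionSpaces.Torus.timeDeriv ψ t x⟫ +
      ⟪U n t x, FunctionSpaces.Torus.convect (U n t) (ψ t) x⟫ + ν * ⟪U n t x, FunctionSpaces.Torus.laplacian (ψ t) x⟫ +
      ⟪F n t x, ψ t x⟫)) (Set.Ici 0) :=
  continuousOn_sliceFunctional_of (hS.continuousOn n) (hS.continuousOn_force n) hψ.timeDeriv.1.continuous
    hψ.1.continuous hψ.isSmoothSpaceTimeOn_laplacian.continuous_stLift_of_univ hψ.isSmooth_slice
    (fun i => (hψ.isSmoothSpaceTimeOn_partialDeriv i).continuous_stLift_of_univ) ν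

/-- **`L¹(0,T)` convergence of the weak-form slice functionals** (Robinson–Rodrigo–Sadowski
2016, Thm. 4.4 Step 4, p. 77; Constantin–Foias 1988, p. 46): with `ψ` a fixed test field,
`∫₀ᵀ |Φ(U n, F n)(t) - Φ(u, f)(t)| dt → 0`, by the slice estimate
`Torus.enorm_sliceFunctional_sub_le` integrated in time (`U n → u`, `F n → f` in `L²ₜₓ`,
`U n`, `u` bounded in `L²ₜₓ`; choose `λ` small, then `n` large). [cite: RobinsonRodrigoSadowski2016, Thm. 4.4 Step 4] -/
theorem IsHopfGalerkinFamily.tendsto_lintegral_sliceFunctional_sub (hS : IsHopfGalerkinFamily ν f u₀ N F U)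
    (hν : 0 < ν) (hu₀ : MemLp u₀ 2 volume)
    (hfm : AEStronglyMeasurable (FunctionSpaces.Torus.stLift f) (volume.restrict (Set.Ioi 0 ×ˢ Set.univ)))
    (hf₂ : ∀ T, 0 < T → ∫⁻ t in Set.Ioo 0 T, ∫⁻ x, ‖f t x‖ₑ ^ 2 < ⊤)
    (hum : AEStronglyMeasurable (FunctionSpaces.Torus.stLift u) (volume.restrict (Set.Ioi 0 ×ˢ Set.univ)))
    (hu : ∀ t, 0 ≤ t → MemLp (u t) 2 volume)
    (hc : ∀ t, 0 ≤ t → ∀ k, Tendsto (fun n => mFourierCoeff (FunctionSpaces.EuclideanSpace.complexify ∘ U n t) k)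
      atTop (𝓝 (mFourierCoeff (FunctionSpaces.EuclideanSpace.complexify ∘ u t) k))) (hT : 0 < T)
    (hψ : FunctionSpaces.Torus.IsSpaceTimeTest T ψ) :
    Tendsto (fun n => ∫⁻ t in Set.Ioo 0 T, ‖(∫ x, (⟪U n t x, FunctionSpaces.Torus.timeDeriv ψ t x⟫ +
        ⟪U n t x, FunctionSpaces.Torus.convect (U n t) (ψ t) x⟫ + ν * ⟪U n t x, FunctionSpaces.Torus.laplacian (ψ t) x⟫ +
        ⟪F n t x, ψ t x⟫)) -
      ∫ x, (⟪u t x, FunctionSpaces.Torus.timeDeriv ψ t x⟫ + ⟪u t x, FunctionSpaces.Torus.convect (u t) (ψ t) x⟫ +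
        ν * ⟪u t x, FunctionSpaces.Torus.laplacian (ψ t) x⟫ + ⟪f t x, ψ t x⟫)‖ₑ) atTop (𝓝 0) := by
  obtain ⟨A, hA, hFA⟩ := hS.exists_force_bound hfm hf₂ hT
  obtain ⟨Y, hYdef⟩ : ∃ Y : ℝ, Y = 2 * (∫ x, ‖u₀ x‖ ^ 2) + 4 * T * A.toReal := ⟨_, rfl⟩
  have hYn : ∀ n, ∀ t ∈ Set.Icc 0 T, ∫ x, ‖U n t x‖ ^ 2 ≤ Y := fun n t ht =>
    (hS.integral_norm_sq_le hν.le hT hA n (hFA n) ht).trans (by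
      have := hS.integral_norm_sq_zero_le n
      rw [hYdef]; linarith)
  have hYu : ∀ t ∈ Set.Icc 0 T, ∫ x, ‖u t x‖ ^ 2 ≤ Y := fun t ht => by
    rw [hYdef]; exact hS.integral_norm_sq_limit_le hν.le hu₀ hu hc hT hA hFA ht
  have hY0 : 0 ≤ Y := le_trans (integral_nonneg fun x => sq_nonneg _) (hYu 0 ⟨le_rfl, hT.le⟩)
  obtain ⟨Kp, KL, Kq, C, hC0, hKp, hKL, hKq, hC⟩ := hψ.exists_bounds
  -- the space–time quantities
  have hX : Tendsto (fun n => ∫⁻ τ in Set.Ioo 0 T, ∫⁻ x, ‖F n τ x - f τ x‖ₑ ^ 2) atTop (𝓝 0) :=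
    hS.tendsto_force T hT
  have hZ : Tendsto (fun n => ∫⁻ τ in Set.Ioo 0 T, ∫⁻ x, ‖U n τ x - u τ x‖ₑ ^ 2) atTop (𝓝 0) :=
    hS.tendsto_lintegral_enorm_sub_sq hν hu₀ hfm hf₂ hum hu hc hT
  have hBU : ∀ n, ∫⁻ τ in Set.Ioo 0 T, ∫⁻ x, ‖U n τ x‖ₑ ^ 2 ≤ ENNReal.ofReal (T * Y) := by
    intro n
    calc ∫⁻ τ in Set.Ioo 0 T, ∫⁻ x, ‖U n τ x‖ₑ ^ 2 ≤ ∫⁻ _ in Set.Ioo 0 T, ENNReal.ofReal Y := by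
          refine setLIntegral_mono' measurableSet_Ioo fun τ hτ => ?_
          rw [← ofReal_integral_norm_sq_slice (hS.continuousOn n) hτ.1.le]
          exact ENNReal.ofReal_le_ofReal (hYn n τ ⟨hτ.1.le, hτ.2.le⟩)
      _ = ENNReal.ofReal (T * Y) := by
          rw [setLIntegral_const, Real.volume_Ioo, sub_zero, ← ENNReal.ofReal_mul hY0, mul_comm]
  have hBu : ∫⁻ τ in Set.Ioo 0 T, ∫⁻ x, ‖u τ x‖ₑ ^ 2 ≤ ENNReal.ofReal (T * Y) := by
    calc ∫⁻ τ in Set.Ioo 0 T, ∫⁻ x, ‖u τ x‖ₑ ^ 2 ≤ ∫⁻ _ in Set.Ioo 0 T, ENNReal.ofReal Y := by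
          refine setLIntegral_mono' measurableSet_Ioo fun τ hτ => ?_
          rw [Torus.lintegral_enorm_sq_eq_ofReal (hu τ hτ.1.le)]
          exact ENNReal.ofReal_le_ofReal (hYu τ ⟨hτ.1.le, hτ.2.le⟩)
      _ = ENNReal.ofReal (T * Y) := by
          rw [setLIntegral_const, Real.volume_Ioo, sub_zero, ← ENNReal.ofReal_mul hY0, mul_comm]
  -- measurability in `τ`
  have hm1 : ∀ n, AEMeasurable (fun τ => ∫⁻ x, ‖F n τ x - f τ x‖ₑ ^ 2) (volume.restrict (Set.Ioo 0 T)) :=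
    fun n => Torus.aemeasurable_lintegral_enorm_sub_sq (hS.aestronglyMeasurable_stLift_force n) hfm T
  have hm2 : ∀ n, AEMeasurable (fun τ => ∫⁻ x, ‖U n τ x‖ₑ ^ 2) (volume.restrict (Set.Ioo 0 T)) :=
    fun n => Torus.aemeasurable_lintegral_enorm_sq (hS.aestronglyMeasurable_stLift n) T
  have hm3 : ∀ n, AEMeasurable (fun τ => ∫⁻ x, ‖U n τ x - u τ x‖ₑ ^ 2) (volume.restrict (Set.Ioo 0 T)) :=
    fun n => Torus.aemeasurable_lintegral_enorm_sub_sq (hS.aestronglyMeasurable_stLift n) hum T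
  have hm4 : AEMeasurable (fun τ => ∫⁻ x, ‖u τ x‖ₑ ^ 2) (volume.restrict (Set.Ioo 0 T)) :=
    Torus.aemeasurable_lintegral_enorm_sq hum T
  -- integrate the slice estimate
  set Kc : ℝ≥0∞ := ENNReal.ofReal (Kp ^ 2 + ν ^ 2 * KL ^ 2 + Kq ^ 2) with hKc
  have hint : ∀ {lam : ℝ}, 0 < lam → ∀ n,
      ∫⁻ t in Set.Ioo 0 T, ‖(∫ x, (⟪U n t x, FunctionSpaces.Torus.timeDeriv ψ t x⟫ +
          ⟪U n t x, FunctionSpaces.Torus.convect (U n t) (ψ t) x⟫ + ν * ⟪U n t x, FunctionSpaces.Torus.laplacian (ψ t) x⟫ +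
          ⟪F n t x, ψ t x⟫)) -
        ∫ x, (⟪u t x, FunctionSpaces.Torus.timeDeriv ψ t x⟫ + ⟪u t x, FunctionSpaces.Torus.convect (u t) (ψ t) x⟫ +
          ν * ⟪u t x, FunctionSpaces.Torus.laplacian (ψ t) x⟫ + ⟪f t x, ψ t x⟫)‖ₑ ≤
        ENNReal.ofReal (lam / 2) * (Kc * ENNReal.ofReal T + ENNReal.ofReal (C ^ 2) *
          (ENNReal.ofReal (T * Y) + ENNReal.ofReal (T * Y))) +
          ENNReal.ofReal (2 * lam)⁻¹ * (4 * (∫⁻ τ in Set.Ioo 0 T, ∫⁻ x, ‖U n τ x - u τ x‖ₑ ^ 2) +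
            ∫⁻ τ in Set.Ioo 0 T, ∫⁻ x, ‖F n τ x - f τ x‖ₑ ^ 2) := by
    intro lam hlam n
    have hpt : ∀ᵐ t ∂(volume.restrict (Set.Ioo 0 T)),
        ‖(∫ x, (⟪U n t x, FunctionSpaces.Torus.timeDeriv ψ t x⟫ +
            ⟪U n t x, FunctionSpaces.Torus.convect (U n t) (ψ t) x⟫ + ν * ⟪U n t x, FunctionSpaces.Torus.laplacian (ψ t) x⟫ +
            ⟪F n t x, ψ t x⟫)) -
          ∫ x, (⟪u t x, FunctionSpaces.Torus.timeDeriv ψ t x⟫ + ⟪u t x, FunctionSpaces.Torus.convect (u t) (ψ t) x⟫ +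
            ν * ⟪u t x, FunctionSpaces.Torus.laplacian (ψ t) x⟫ + ⟪f t x, ψ t x⟫)‖ₑ ≤
          ENNReal.ofReal (2 * lam)⁻¹ * (4 * (∫⁻ x, ‖U n t x - u t x‖ₑ ^ 2) + ∫⁻ x, ‖F n t x - f t x‖ₑ ^ 2) +
            ENNReal.ofReal (lam / 2) * (Kc + ENNReal.ofReal (C ^ 2) *
              ((∫⁻ x, ‖U n t x‖ₑ ^ 2) + ∫⁻ x, ‖u t x‖ₑ ^ 2)) := by
      filter_upwards [FunctionSpaces.Torus.ae_memLp_slice hfm (hf₂ T hT), ae_restrict_mem measurableSet_Ioo]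
        with t hft ht
      have ht' : t ∈ Set.Icc 0 T := ⟨ht.1.le, ht.2.le⟩
      have hFm : MemLp (F n t) 2 volume := (hS.continuous_force_slice n ht.1.le).memLp_of_hasCompactSupport
        (HasCompactSupport.of_compactSpace _)
      exact Torus.enorm_sliceFunctional_sub_le (hS.memLp_slice n ht.1.le) (hu t ht.1.le) hFm hft
        (hψ.isSmooth_slice t) (hψ.timeDeriv.isSmooth_slice t).continuous
        (hψ.isSmooth_slice t).laplacian.continuous (hC t ht') (hKp t ht') (hKL t ht') (hKq t ht') ν hlam
    refine (lintegral_mono_ae hpt).trans ?_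
    have mA : AEMeasurable (fun t => 4 * (∫⁻ x, ‖U n t x - u t x‖ₑ ^ 2) + ∫⁻ x, ‖F n t x - f t x‖ₑ ^ 2)
        (volume.restrict (Set.Ioo 0 T)) := ((hm3 n).const_mul _).add (hm1 n)
    have m24 : AEMeasurable (fun t => (∫⁻ x, ‖U n t x‖ₑ ^ 2) + ∫⁻ x, ‖u t x‖ₑ ^ 2)
        (volume.restrict (Set.Ioo 0 T)) := (hm2 n).add hm4
    have mB : AEMeasurable (fun t => Kc + ENNReal.ofReal (C ^ 2) *
        ((∫⁻ x, ‖U n t x‖ₑ ^ 2) + ∫⁻ x, ‖u t x‖ₑ ^ 2)) (volume.restrict (Set.Ioo 0 T)) :=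
      (m24.const_mul _).const_add _
    rw [lintegral_add_left' (mA.const_mul _), lintegral_const_mul'' _ mA, lintegral_const_mul'' _ mB,
      lintegral_add_left' ((hm3 n).const_mul _), lintegral_const_mul'' _ (hm3 n),
      lintegral_add_left' aemeasurable_const, lintegral_const_mul'' _ m24,
      lintegral_add_left' (hm2 n), setLIntegral_const, Real.volume_Ioo, sub_zero]
    rw [add_comm]
    have h1 := hBU n
    gcongr
  refine ENNReal.tendsto_zero_of_forall_le_ofReal_mul_add
    (C := Kc * ENNReal.ofReal T + ENNReal.ofReal (C ^ 2) * (ENNReal.ofReal (T * Y) + ENNReal.ofReal (T * Y)))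
    ?_ (X := fun lam n => ENNReal.ofReal (2 * (2 * lam))⁻¹ *
      (4 * (∫⁻ τ in Set.Ioo 0 T, ∫⁻ x, ‖U n τ x - u τ x‖ₑ ^ 2) +
        ∫⁻ τ in Set.Ioo 0 T, ∫⁻ x, ‖F n τ x - f τ x‖ₑ ^ 2)) (fun lam hlam => ?_) (fun lam hlam => ?_)
  · exact ENNReal.add_ne_top.2 ⟨ENNReal.mul_ne_top ENNReal.ofReal_ne_top ENNReal.ofReal_ne_top,
      ENNReal.mul_ne_top ENNReal.ofReal_ne_top (ENNReal.add_ne_top.2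
        ⟨ENNReal.ofReal_ne_top, ENNReal.ofReal_ne_top⟩)⟩
  · have h4 : Tendsto (fun n => (4 : ℝ≥0∞) * ∫⁻ τ in Set.Ioo 0 T, ∫⁻ x, ‖U n τ x - u τ x‖ₑ ^ 2) atTop
        (𝓝 ((4 : ℝ≥0∞) * 0)) :=
      ENNReal.Tendsto.const_mul hZ (Or.inr (by norm_num))
    have h := ENNReal.Tendsto.const_mul (h4.add hX) (a := ENNReal.ofReal (2 * (2 * lam))⁻¹)
      (Or.inr ENNReal.ofReal_ne_top)
    simpa using h
  · refine Eventually.of_forall fun n => ?_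
    have h := hint (lam := 2 * lam) (by positivity) n
    rwa [show 2 * lam / 2 = lam by ring] at h

/-- **The weak-form functionals converge**: `∫₀ᵀ Φ(U n, F n) → ∫₀ᵀ Φ(u, f)` for every test field
(`tendsto_integral_of_L1` on `(0, T)`). [cite: RobinsonRodrigoSadowski2016, Thm. 4.4 Step 4] -/
theorem IsHopfGalerkinFamily.tendsto_integral_sliceFunctional (hS : IsHopfGalerkinFamily ν f u₀ N F U)
    (hν : 0 < ν) (hu₀ : MemLp u₀ 2 volume)
    (hfm : AEStronglyMeasurable (FunctionSpaces.Torus.stLift f) (volume.restrict (Set.Ioi 0 ×ˢ Set.univ)))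
    (hf₂ : ∀ T, 0 < T → ∫⁻ t in Set.Ioo 0 T, ∫⁻ x, ‖f t x‖ₑ ^ 2 < ⊤)
    (hum : AEStronglyMeasurable (FunctionSpaces.Torus.stLift u) (volume.restrict (Set.Ioi 0 ×ˢ Set.univ)))
    (hu : ∀ t, 0 ≤ t → MemLp (u t) 2 volume)
    (hc : ∀ t, 0 ≤ t → ∀ k, Tendsto (fun n => mFourierCoeff (FunctionSpaces.EuclideanSpace.complexify ∘ U n t) k)
      atTop (𝓝 (mFourierCoeff (FunctionSpaces.EuclideanSpace.complexify ∘ u t) k))) (hT : 0 < T)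
    (hψ : FunctionSpaces.Torus.IsSpaceTimeTest T ψ) :
    Tendsto (fun n => ∫ t in Set.Ioo 0 T, ∫ x, (⟪U n t x, FunctionSpaces.Torus.timeDeriv ψ t x⟫ +
        ⟪U n t x, FunctionSpaces.Torus.convect (U n t) (ψ t) x⟫ + ν * ⟪U n t x, FunctionSpaces.Torus.laplacian (ψ t) x⟫ +
        ⟪F n t x, ψ t x⟫)) atTop
      (𝓝 (∫ t in Set.Ioo 0 T, ∫ x, (⟪u t x, FunctionSpaces.Torus.timeDeriv ψ t x⟫ +
        ⟪u t x, FunctionSpaces.Torus.convect (u t) (ψ t) x⟫ + ν * ⟪u t x, FunctionSpaces.Torus.laplacian (ψ t) x⟫ +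
        ⟪f t x, ψ t x⟫))) := by
  refine tendsto_integral_of_L1 (μ := volume.restrict (Set.Ioo 0 T)) _
    (aestronglyMeasurable_sliceFunctional_limit hψ hfm hum ν) (Eventually.of_forall fun n => ?_)
    (hS.tendsto_lintegral_sliceFunctional_sub hν hu₀ hfm hf₂ hum hu hc hT hψ)
  exact ((hS.continuousOn_sliceFunctional hψ n).mono Set.Icc_subset_Ici_self).integrableOn_Icc.mono_set
    Set.Ioo_subset_Icc_self

end Limit

/-! ## The truncation error `E_n(ψ) - E_n(P_{N n} ψ)` and the weak form of the limit -/

section WeakForm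

variable {T : ℝ} {ψ : ℝ → UnitAddTorus d → EuclideanSpace ℝ d}

/-- **Slice bound for the truncation error of the weak-form functional**: for `t ∈ [0, T]`,
given the uniform truncation errors `e₀, e₁, e₂` of `ψ, ∂ₜψ, Δψ` and `e₃` of `∑ᵢ ‖∂ᵢψ - P_M ∂ᵢψ‖`
at time `t`,
`|Φₙ(ψ)(t) - Φₙ(P_M ψ)(t)| ≤ (e₁/2 + |ν|e₂/2 + e₃) ∫‖U n t‖² + (e₀/2) ∫‖F n t‖² + (e₁/2 + |ν|e₂/2 + e₀/2)`.
[cite: RobinsonRodrigoSadowski2016, Thm. 4.4 Step 4] -/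
theorem IsHopfGalerkinFamily.norm_sliceFunctional_trunc_sub_le (hS : IsHopfGalerkinFamily ν f u₀ N F U)
    (hψ : FunctionSpaces.Torus.IsSpaceTimeTest T ψ) (n M : ℕ) {t : ℝ} (ht0 : 0 ≤ t) {e₀ e₁ e₂ e₃ : ℝ}
    (he₀ : 0 ≤ e₀) (he₁ : 0 ≤ e₁) (he₂ : 0 ≤ e₂)
    (h₀ : ∀ x, ‖ψ t x - FunctionSpaces.Torus.fourierTruncate M (ψ t) x‖ ≤ e₀)
    (h₁ : ∀ x, ‖FunctionSpaces.Torus.timeDeriv ψ t x - FunctionSpaces.Torus.fourierTruncate M (FunctionSpaces.Torus.timeDeriv ψ t) x‖ ≤ e₁)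
    (h₂ : ∀ x, ‖FunctionSpaces.Torus.laplacian (ψ t) x - FunctionSpaces.Torus.fourierTruncate M (FunctionSpaces.Torus.laplacian (ψ t)) x‖ ≤ e₂)
    (h₃ : ∀ x, ∑ i, ‖FunctionSpaces.Torus.partialDeriv i (ψ t) x -
      FunctionSpaces.Torus.fourierTruncate M (FunctionSpaces.Torus.partialDeriv i (ψ t)) x‖ ≤ e₃) :
    ‖(∫ x, (⟪U n t x, FunctionSpaces.Torus.timeDeriv ψ t x⟫ +
        ⟪U n t x, FunctionSpaces.Torus.convect (U n t) (ψ t) x⟫ + ν * ⟪U n t x, FunctionSpaces.Torus.laplacian (ψ t) x⟫ +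
        ⟪F n t x, ψ t x⟫)) - ∫ x, (⟪U n t x, FunctionSpaces.Torus.fourierTruncate M (FunctionSpaces.Torus.timeDeriv ψ t) x⟫ +
        ⟪U n t x, FunctionSpaces.Torus.convect (U n t) (fun y => FunctionSpaces.Torus.fourierTruncate M (ψ t) y) x⟫ +
        ν * ⟪U n t x, FunctionSpaces.Torus.laplacian (fun y => FunctionSpaces.Torus.fourierTruncate M (ψ t) y) x⟫ +
        ⟪F n t x, FunctionSpaces.Torus.fourierTruncate M (ψ t) x⟫)‖ ≤
      (e₁ / 2 + |ν| * e₂ / 2 + e₃) * (∫ x, ‖U n t x‖ ^ 2) + e₀ / 2 * (∫ x, ‖F n t x‖ ^ 2) +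
        (e₁ / 2 + |ν| * e₂ / 2 + e₀ / 2) := by
  have hcU : Continuous (U n t) := hS.continuous_slice n ht0
  have hcF : Continuous (F n t) := hS.continuous_force_slice n ht0
  have hmU : MemLp (U n t) 2 volume := hS.memLp_slice n ht0
  have hmF : MemLp (F n t) 2 volume := hcF.memLp_of_hasCompactSupport (HasCompactSupport.of_compactSpace _)
  have hPs := Torus.isSmooth_fourierTruncate_slice ψ M t
  have hsl := hψ.isSmooth_slice t
  have i1 := Torus.integrable_weakIntegrand hmU hmF hsl (hψ.timeDeriv.isSmooth_slice t).continuous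
    hsl.laplacian.continuous ν
  have hPp : Continuous (fun x => FunctionSpaces.Torus.fourierTruncate M (FunctionSpaces.Torus.timeDeriv ψ t) x) := by
    rw [show (fun x => FunctionSpaces.Torus.fourierTruncate M (FunctionSpaces.Torus.timeDeriv ψ t) x) =
      FunctionSpaces.Torus.fourierTruncate M (FunctionSpaces.Torus.timeDeriv ψ t) from rfl, FunctionSpaces.Torus.fourierTruncate_eq]
    exact (FunctionSpaces.Torus.isSmooth_realTrigPoly _ _).continuous
  have i2 := Torus.integrable_weakIntegrand hmU hmF hPs hPp hPs.laplacian.continuous ν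
  rw [← integral_sub i1 i2]
  -- pointwise
  have hpt : ∀ x, ‖(⟪U n t x, FunctionSpaces.Torus.timeDeriv ψ t x⟫ +
      ⟪U n t x, FunctionSpaces.Torus.convect (U n t) (ψ t) x⟫ + ν * ⟪U n t x, FunctionSpaces.Torus.laplacian (ψ t) x⟫ +
      ⟪F n t x, ψ t x⟫) - (⟪U n t x, FunctionSpaces.Torus.fourierTruncate M (FunctionSpaces.Torus.timeDeriv ψ t) x⟫ +
      ⟪U n t x, FunctionSpaces.Torus.convect (U n t) (fun y => FunctionSpaces.Torus.fourierTruncate M (ψ t) y) x⟫ +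
      ν * ⟪U n t x, FunctionSpaces.Torus.laplacian (fun y => FunctionSpaces.Torus.fourierTruncate M (ψ t) y) x⟫ +
      ⟪F n t x, FunctionSpaces.Torus.fourierTruncate M (ψ t) x⟫)‖ ≤
      (e₁ / 2 + |ν| * e₂ / 2 + e₃) * ‖U n t x‖ ^ 2 + e₀ / 2 * ‖F n t x‖ ^ 2 +
        (e₁ / 2 + |ν| * e₂ / 2 + e₀ / 2) := by
    intro x
    have hd : (⟪U n t x, FunctionSpaces.Torus.timeDeriv ψ t x⟫ +
        ⟪U n t x, FunctionSpaces.Torus.convect (U n t) (ψ t) x⟫ + ν * ⟪U n t x, FunctionSpaces.Torus.laplacian (ψ t) x⟫ +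
        ⟪F n t x, ψ t x⟫) - (⟪U n t x, FunctionSpaces.Torus.fourierTruncate M (FunctionSpaces.Torus.timeDeriv ψ t) x⟫ +
        ⟪U n t x, FunctionSpaces.Torus.convect (U n t) (fun y => FunctionSpaces.Torus.fourierTruncate M (ψ t) y) x⟫ +
        ν * ⟪U n t x, FunctionSpaces.Torus.laplacian (fun y => FunctionSpaces.Torus.fourierTruncate M (ψ t) y) x⟫ +
        ⟪F n t x, FunctionSpaces.Torus.fourierTruncate M (ψ t) x⟫) =
        ⟪U n t x, FunctionSpaces.Torus.timeDeriv ψ t x - FunctionSpaces.Torus.fourierTruncate M (FunctionSpaces.Torus.timeDeriv ψ t) x⟫ +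
        ⟪U n t x, FunctionSpaces.Torus.convect (U n t) (fun y => ψ t y - FunctionSpaces.Torus.fourierTruncate M (ψ t) y) x⟫ +
        ν * ⟪U n t x, FunctionSpaces.Torus.laplacian (ψ t) x - FunctionSpaces.Torus.fourierTruncate M (FunctionSpaces.Torus.laplacian (ψ t)) x⟫ +
        ⟪F n t x, ψ t x - FunctionSpaces.Torus.fourierTruncate M (ψ t) x⟫ := by
      rw [Torus.convect_sub_apply hsl hPs, FunctionSpaces.Torus.laplacian_fourierTruncate hsl]
      simp only [inner_sub_right]
      ring
    rw [hd, Real.norm_eq_abs]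
    refine abs_weakIntegrand_trunc_le _ _ _ _ _ _ ν he₀ he₁ he₂ (h₁ x) (h₂ x) (h₀ x) ?_
    have e3 : ∑ i, ‖FunctionSpaces.Torus.partialDeriv i (fun y => ψ t y - FunctionSpaces.Torus.fourierTruncate M (ψ t) y) x‖ ≤ e₃ := by
      refine le_trans (le_of_eq (Finset.sum_congr rfl fun i _ => ?_)) (h₃ x)
      rw [Torus.partialDeriv_sub_apply hsl hPs, FunctionSpaces.Torus.partialDeriv_fourierTruncate hsl]
    exact (FunctionSpaces.Torus.norm_convect_le (U n t) ((hsl.sub hPs).isContDiff (by simp)) x).trans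
      (mul_le_mul_of_nonneg_left e3 (norm_nonneg _))
  -- integrate
  have iU : Integrable (fun x => ‖U n t x‖ ^ 2) volume := (hcU.norm.pow 2).integrable_unitAddTorus
  have iF : Integrable (fun x => ‖F n t x‖ ^ 2) volume := (hcF.norm.pow 2).integrable_unitAddTorus
  have i12 : Integrable (fun x => (e₁ / 2 + |ν| * e₂ / 2 + e₃) * ‖U n t x‖ ^ 2 + e₀ / 2 * ‖F n t x‖ ^ 2)
      volume := (iU.const_mul _).add (iF.const_mul _)
  have i123 : Integrable (fun x => (e₁ / 2 + |ν| * e₂ / 2 + e₃) * ‖U n t x‖ ^ 2 + e₀ / 2 * ‖F n t x‖ ^ 2 +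
      (e₁ / 2 + |ν| * e₂ / 2 + e₀ / 2)) volume := i12.add (integrable_const _)
  refine (norm_integral_le_of_norm_le i123 (ae_of_all _ hpt)).trans (le_of_eq ?_)
  rw [integral_add i12 (integrable_const _), integral_add (iU.const_mul _) (iF.const_mul _),
    integral_const_mul, integral_const_mul, integral_const]
  simp [Measure.real]

/-- **The weak-form functional of the approximations tends to zero** (Robinson–Rodrigo–Sadowski
2016, Thm. 4.4 Step 4, p. 77: `P_n ψ → ψ` in `C¹`, so the Galerkin identity tested against `P_n ψ`
differs from the one tested against `ψ` by `o(1)` times the uniform bounds): with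
`E_n(ψ) = ∫₀ᵀ Φ(U n, F n) + ∫ ⟪U n 0, ψ(0)⟫`, `E_n(ψ) → 0`, because
`E_n(P_{N n} ψ) = 0` (`galerkin_weak_identity`) and
`|E_n(ψ) - E_n(P_{N n}ψ)| ≤ τ_{N n} · const` with the lattice tail `τ_M → 0`
(`Torus.exists_norm_sub_fourierTruncate_le_spaceTime`). [cite: RobinsonRodrigoSadowski2016, Thm. 4.4 Step 4] -/
theorem IsHopfGalerkinFamily.tendsto_weakFunctional (hS : IsHopfGalerkinFamily ν f u₀ N F U)
    (hν : 0 ≤ ν) (_hu₀ : MemLp u₀ 2 volume)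
    (hfm : AEStronglyMeasurable (FunctionSpaces.Torus.stLift f) (volume.restrict (Set.Ioi 0 ×ˢ Set.univ)))
    (hf₂ : ∀ T, 0 < T → ∫⁻ t in Set.Ioo 0 T, ∫⁻ x, ‖f t x‖ₑ ^ 2 < ⊤) (hT : 0 < T)
    (hψ : FunctionSpaces.Torus.IsSpaceTimeTest T ψ) (hdiv : FunctionSpaces.Torus.IsDivFreeTest ψ) :
    Tendsto (fun n => (∫ t in Set.Ioo 0 T, ∫ x, (⟪U n t x, FunctionSpaces.Torus.timeDeriv ψ t x⟫ +
        ⟪U n t x, FunctionSpaces.Torus.convect (U n t) (ψ t) x⟫ + ν * ⟪U n t x, FunctionSpaces.Torus.laplacian (ψ t) x⟫ +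
        ⟪F n t x, ψ t x⟫)) + ∫ x, ⟪U n 0 x, ψ 0 x⟫) atTop (𝓝 0) := by
  obtain ⟨A, hA, hFA⟩ := hS.exists_force_bound hfm hf₂ hT
  obtain ⟨Y, hYdef⟩ : ∃ Y : ℝ, Y = 2 * (∫ x, ‖u₀ x‖ ^ 2) + 4 * T * A.toReal := ⟨_, rfl⟩
  have hYn : ∀ n, ∀ t ∈ Set.Icc 0 T, ∫ x, ‖U n t x‖ ^ 2 ≤ Y := fun n t ht =>
    (hS.integral_norm_sq_le hν hT hA n (hFA n) ht).trans (by
      have := hS.integral_norm_sq_zero_le n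
      rw [hYdef]; linarith)
  have hY0 : 0 ≤ Y := le_trans (integral_nonneg fun x => sq_nonneg _) (hYn 0 0 ⟨le_rfl, hT.le⟩)
  -- uniform truncation errors of the test data
  obtain ⟨K₀, hK₀0, hK₀⟩ := FunctionSpaces.Torus.exists_norm_sub_fourierTruncate_le_spaceTime (hψ.isSmoothSpaceTimeOn Set.univ) T
  obtain ⟨K₁, hK₁0, hK₁⟩ := FunctionSpaces.Torus.exists_norm_sub_fourierTruncate_le_spaceTime
    (hψ.timeDeriv.isSmoothSpaceTimeOn Set.univ) T
  obtain ⟨K₂, hK₂0, hK₂⟩ := FunctionSpaces.Torus.exists_norm_sub_fourierTruncate_le_spaceTime hψ.isSmoothSpaceTimeOn_laplacian T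
  choose K₃ hK₃0 hK₃ using fun i => FunctionSpaces.Torus.exists_norm_sub_fourierTruncate_le_spaceTime
    (hψ.isSmoothSpaceTimeOn_partialDeriv i) T
  obtain ⟨τ, hτdef⟩ : ∃ τ : ℕ → ℝ, τ = fun M => ∑' k : {k // k ∉ FunctionSpaces.Torus.freqBall (d := d) M},
    ((1 + FunctionSpaces.Torus.freqNormSq (k : d → ℤ)) ^ Fintype.card d)⁻¹ := ⟨_, rfl⟩
  have hτ0 : ∀ M, 0 ≤ τ M := fun M => by
    rw [hτdef]
    exact tsum_nonneg fun k => inv_nonneg.2 (pow_nonneg (by linarith [FunctionSpaces.Torus.freqNormSq_nonneg (k : d → ℤ)]) _)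
  have hτlim : Tendsto (fun n => τ (N n)) atTop (𝓝 0) := by
    rw [hτdef]
    exact FunctionSpaces.Torus.tendsto_tsum_compl_freqBall_inv_pow.comp hS.tendsto_order
  obtain ⟨K3, hK3def⟩ : ∃ K3 : ℝ, K3 = ∑ i, K₃ i := ⟨_, rfl⟩
  have hK30 : 0 ≤ K3 := by rw [hK3def]; exact Finset.sum_nonneg fun i _ => hK₃0 i
  obtain ⟨a, hadef⟩ : ∃ a : ℝ, a = (K₁ + |ν| * K₂) / 2 + K3 := ⟨_, rfl⟩
  obtain ⟨c, hcdef⟩ : ∃ c : ℝ, c = (K₁ + |ν| * K₂) / 2 + K₀ / 2 := ⟨_, rfl⟩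
  have ha0 : 0 ≤ a := by rw [hadef]; positivity
  have hc0 : 0 ≤ c := by rw [hcdef]; positivity
  obtain ⟨Mc, hMcdef⟩ : ∃ Mc : ℝ, Mc = a * (T * Y) + K₀ / 2 * A.toReal + c * T +
    K₀ * (2⁻¹ + 2⁻¹ * ∫ x, ‖u₀ x‖ ^ 2) := ⟨_, rfl⟩
  -- coefficient continuity for the truncated tests
  have hcoef : ∀ (b : ℝ → UnitAddTorus d → EuclideanSpace ℝ d), FunctionSpaces.Torus.IsSmoothSpaceTimeOn Set.univ b →
      ∀ k, Continuous fun t => mFourierCoeff (FunctionSpaces.EuclideanSpace.complexify ∘ b t) k := by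
    intro b hb k
    rw [← continuousOn_univ]
    exact FunctionSpaces.Torus.continuousOn_mFourierCoeff_of_continuousOn_stLift hb.continuousOn_stLift k
  have hbound : ∀ n, |(∫ t in Set.Ioo 0 T, ∫ x, (⟪U n t x, FunctionSpaces.Torus.timeDeriv ψ t x⟫ +
      ⟪U n t x, FunctionSpaces.Torus.convect (U n t) (ψ t) x⟫ + ν * ⟪U n t x, FunctionSpaces.Torus.laplacian (ψ t) x⟫ +
      ⟪F n t x, ψ t x⟫)) + ∫ x, ⟪U n 0 x, ψ 0 x⟫| ≤ τ (N n) * Mc := by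
    intro n
    have hU0c : Continuous (U n 0) := hS.continuous_slice n le_rfl
    -- the Galerkin identity against `P_(N n) ψ`, set-integral form
    have hGW := hS.galerkin_weak_identity n hT hψ hdiv
    rw [intervalIntegral.integral_of_le hT.le, integral_Ioc_eq_integral_Ioo] at hGW
    -- continuity of the two slice functionals on `[0, T]`
    have hΦ : ContinuousOn _ (Set.Icc 0 T) := (hS.continuousOn_sliceFunctional hψ n).mono Set.Icc_subset_Ici_self
    have hPcont : Continuous (FunctionSpaces.Torus.stLift fun t x => FunctionSpaces.Torus.fourierTruncate (N n) (ψ t) x) :=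
      Torus.continuous_stLift_fourierTruncate (hcoef ψ (hψ.isSmoothSpaceTimeOn Set.univ)) _
    have hPp : Continuous (FunctionSpaces.Torus.stLift fun t x => FunctionSpaces.Torus.fourierTruncate (N n) (FunctionSpaces.Torus.timeDeriv ψ t) x) :=
      Torus.continuous_stLift_fourierTruncate (hcoef _ (hψ.timeDeriv.isSmoothSpaceTimeOn Set.univ)) _
    have hPL : Continuous (FunctionSpaces.Torus.stLift fun t x =>
        FunctionSpaces.Torus.laplacian (fun y => FunctionSpaces.Torus.fourierTruncate (N n) (ψ t) y) x) := by
      have h : (fun t x => FunctionSpaces.Torus.laplacian (fun y => FunctionSpaces.Torus.fourierTruncate (N n) (ψ t) y) x) =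
          fun t x => FunctionSpaces.Torus.fourierTruncate (N n) (FunctionSpaces.Torus.laplacian (ψ t)) x := by
        funext t x; exact FunctionSpaces.Torus.laplacian_fourierTruncate (hψ.isSmooth_slice t) _ x
      rw [h]
      exact Torus.continuous_stLift_fourierTruncate (hcoef _ hψ.isSmoothSpaceTimeOn_laplacian) _
    have hPD : ∀ i, Continuous (FunctionSpaces.Torus.stLift fun t =>
        FunctionSpaces.Torus.partialDeriv i (fun y => FunctionSpaces.Torus.fourierTruncate (N n) (ψ t) y)) := by
      intro i
      have h : (fun t => FunctionSpaces.Torus.partialDeriv i (fun y => FunctionSpaces.Torus.fourierTruncate (N n) (ψ t) y)) =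
          fun t x => FunctionSpaces.Torus.fourierTruncate (N n) (FunctionSpaces.Torus.partialDeriv i (ψ t)) x := by
        funext t x; exact FunctionSpaces.Torus.partialDeriv_fourierTruncate (hψ.isSmooth_slice t) _ i x
      rw [h]
      exact Torus.continuous_stLift_fourierTruncate (hcoef _ (hψ.isSmoothSpaceTimeOn_partialDeriv i)) _
    have hΦP : ContinuousOn _ (Set.Icc 0 T) := (continuousOn_sliceFunctional_of (hS.continuousOn n)
      (hS.continuousOn_force n) hPp hPcont hPL (Torus.isSmooth_fourierTruncate_slice ψ (N n)) hPD ν).mono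
      Set.Icc_subset_Ici_self
    have iΦ := (hΦ.integrableOn_Icc (μ := volume)).mono_set Set.Ioo_subset_Icc_self
    have iΦP := (hΦP.integrableOn_Icc (μ := volume)).mono_set Set.Ioo_subset_Icc_self
    -- `E_n = ∫ (Φ - Φ^P) + ∫ ⟪U n 0, ψ 0 - P ψ 0⟫`
    have i0 : Integrable (fun x => ⟪U n 0 x, ψ 0 x⟫) volume :=
      FunctionSpaces.Torus.integrable_inner_of_continuous hU0c.integrable_unitAddTorus (hψ.isSmooth_slice 0).continuous
    have i0P : Integrable (fun x => ⟪U n 0 x, FunctionSpaces.Torus.fourierTruncate (N n) (ψ 0) x⟫) volume :=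
      FunctionSpaces.Torus.integrable_inner_of_continuous hU0c.integrable_unitAddTorus
        (Torus.isSmooth_fourierTruncate_slice ψ (N n) 0).continuous
    have hsplit : (∫ t in Set.Ioo 0 T, ∫ x, (⟪U n t x, FunctionSpaces.Torus.timeDeriv ψ t x⟫ +
        ⟪U n t x, FunctionSpaces.Torus.convect (U n t) (ψ t) x⟫ + ν * ⟪U n t x, FunctionSpaces.Torus.laplacian (ψ t) x⟫ +
        ⟪F n t x, ψ t x⟫)) + ∫ x, ⟪U n 0 x, ψ 0 x⟫ =
        (∫ t in Set.Ioo 0 T, ((∫ x, (⟪U n t x, FunctionSpaces.Torus.timeDeriv ψ t x⟫ +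
          ⟪U n t x, FunctionSpaces.Torus.convect (U n t) (ψ t) x⟫ + ν * ⟪U n t x, FunctionSpaces.Torus.laplacian (ψ t) x⟫ +
          ⟪F n t x, ψ t x⟫)) - ∫ x, (⟪U n t x, FunctionSpaces.Torus.fourierTruncate (N n) (FunctionSpaces.Torus.timeDeriv ψ t) x⟫ +
          ⟪U n t x, FunctionSpaces.Torus.convect (U n t) (fun y => FunctionSpaces.Torus.fourierTruncate (N n) (ψ t) y) x⟫ +
          ν * ⟪U n t x, FunctionSpaces.Torus.laplacian (fun y => FunctionSpaces.Torus.fourierTruncate (N n) (ψ t) y) x⟫ +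
          ⟪F n t x, FunctionSpaces.Torus.fourierTruncate (N n) (ψ t) x⟫))) +
        ∫ x, ⟪U n 0 x, ψ 0 x - FunctionSpaces.Torus.fourierTruncate (N n) (ψ 0) x⟫ := by
      rw [integral_sub iΦ iΦP]
      simp_rw [inner_sub_right]
      rw [integral_sub i0 i0P]
      linarith
    rw [hsplit]
    -- time integration of the slice bound
    have hE : ContinuousOn (fun t => ∫ x, ‖U n t x‖ ^ 2) (Set.Icc 0 T) :=
      (FunctionSpaces.Torus.continuousOn_integral_norm_sq_of_continuousOn_stLift (hS.continuousOn n)).mono Set.Icc_subset_Ici_self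
    have hG : ContinuousOn (fun t => ∫ x, ‖F n t x‖ ^ 2) (Set.Icc 0 T) :=
      (FunctionSpaces.Torus.continuousOn_integral_norm_sq_of_continuousOn_stLift (hS.continuousOn_force n)).mono
        Set.Icc_subset_Ici_self
    have iE := (hE.integrableOn_Icc (μ := volume)).mono_set Set.Ioo_subset_Icc_self
    have iG := (hG.integrableOn_Icc (μ := volume)).mono_set Set.Ioo_subset_Icc_self
    have hEb : ∫ t in Set.Ioo 0 T, ∫ x, ‖U n t x‖ ^ 2 ≤ T * Y := by
      have h := setIntegral_mono_on iE (integrableOn_const (C := Y) measure_Ioo_lt_top.ne) measurableSet_Ioo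
        fun t ht => hYn n t ⟨ht.1.le, ht.2.le⟩
      rwa [setIntegral_const, Real.volume_real_Ioo_of_le hT.le, sub_zero, smul_eq_mul] at h
    have hGb : ∫ t in Set.Ioo 0 T, ∫ x, ‖F n t x‖ ^ 2 ≤ A.toReal := by
      obtain ⟨-, heq⟩ := intervalIntegral_norm_sq_eq_toReal (hS.continuousOn_force n) le_rfl hT.le
      rw [intervalIntegral.integral_of_le hT.le, integral_Ioc_eq_integral_Ioo] at heq
      rw [heq]
      exact ENNReal.toReal_mono hA (hFA n)
    have hslice : ∀ t ∈ Set.Ioo 0 T, ‖(∫ x, (⟪U n t x, FunctionSpaces.Torus.timeDeriv ψ t x⟫ +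
        ⟪U n t x, FunctionSpaces.Torus.convect (U n t) (ψ t) x⟫ + ν * ⟪U n t x, FunctionSpaces.Torus.laplacian (ψ t) x⟫ +
        ⟪F n t x, ψ t x⟫)) - ∫ x, (⟪U n t x, FunctionSpaces.Torus.fourierTruncate (N n) (FunctionSpaces.Torus.timeDeriv ψ t) x⟫ +
        ⟪U n t x, FunctionSpaces.Torus.convect (U n t) (fun y => FunctionSpaces.Torus.fourierTruncate (N n) (ψ t) y) x⟫ +
        ν * ⟪U n t x, FunctionSpaces.Torus.laplacian (fun y => FunctionSpaces.Torus.fourierTruncate (N n) (ψ t) y) x⟫ +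
        ⟪F n t x, FunctionSpaces.Torus.fourierTruncate (N n) (ψ t) x⟫)‖ ≤
        τ (N n) * (a * (∫ x, ‖U n t x‖ ^ 2) + K₀ / 2 * (∫ x, ‖F n t x‖ ^ 2) + c) := by
      intro t ht
      have ht' : t ∈ Set.Icc 0 T := ⟨ht.1.le, ht.2.le⟩
      have hτn := hτ0 (N n)
      have h := hS.norm_sliceFunctional_trunc_sub_le hψ n (N n) ht.1.le
        (e₀ := K₀ * τ (N n)) (e₁ := K₁ * τ (N n)) (e₂ := K₂ * τ (N n)) (e₃ := K3 * τ (N n))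
        (mul_nonneg hK₀0 hτn) (mul_nonneg hK₁0 hτn) (mul_nonneg hK₂0 hτn)
        (fun x => by rw [hτdef]; exact hK₀ _ t ht' x) (fun x => by rw [hτdef]; exact hK₁ _ t ht' x)
        (fun x => by rw [hτdef]; exact hK₂ _ t ht' x)
        (fun x => by
          rw [hK3def, Finset.sum_mul]
          exact Finset.sum_le_sum fun i _ => by rw [hτdef]; exact hK₃ i _ t ht' x)
      refine h.trans (le_of_eq ?_)
      rw [hadef, hcdef]
      ring
    have ibound : IntegrableOn (fun t => τ (N n) * (a * (∫ x, ‖U n t x‖ ^ 2) + K₀ / 2 * (∫ x, ‖F n t x‖ ^ 2) + c))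
        (Set.Ioo 0 T) volume :=
      (((iE.const_mul _).add (iG.const_mul _)).add (integrableOn_const measure_Ioo_lt_top.ne)).const_mul _
    have h1 : ‖∫ t in Set.Ioo 0 T, ((∫ x, (⟪U n t x, FunctionSpaces.Torus.timeDeriv ψ t x⟫ +
        ⟪U n t x, FunctionSpaces.Torus.convect (U n t) (ψ t) x⟫ + ν * ⟪U n t x, FunctionSpaces.Torus.laplacian (ψ t) x⟫ +
        ⟪F n t x, ψ t x⟫)) - ∫ x, (⟪U n t x, FunctionSpaces.Torus.fourierTruncate (N n) (FunctionSpaces.Torus.timeDeriv ψ t) x⟫ +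
        ⟪U n t x, FunctionSpaces.Torus.convect (U n t) (fun y => FunctionSpaces.Torus.fourierTruncate (N n) (ψ t) y) x⟫ +
        ν * ⟪U n t x, FunctionSpaces.Torus.laplacian (fun y => FunctionSpaces.Torus.fourierTruncate (N n) (ψ t) y) x⟫ +
        ⟪F n t x, FunctionSpaces.Torus.fourierTruncate (N n) (ψ t) x⟫))‖ ≤
        τ (N n) * (a * (T * Y) + K₀ / 2 * A.toReal + c * T) := by
      refine (norm_integral_le_of_norm_le ibound ((ae_restrict_mem measurableSet_Ioo).mono hslice)).trans ?_
      have i12 : IntegrableOn (fun t => a * (∫ x, ‖U n t x‖ ^ 2) + K₀ / 2 * (∫ x, ‖F n t x‖ ^ 2))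
          (Set.Ioo 0 T) volume := (iE.const_mul _).add (iG.const_mul _)
      rw [integral_const_mul, integral_add i12 (integrableOn_const measure_Ioo_lt_top.ne),
        integral_add (iE.const_mul _) (iG.const_mul _), integral_const_mul, integral_const_mul,
        setIntegral_const, Real.volume_real_Ioo_of_le hT.le, sub_zero, smul_eq_mul]
      refine mul_le_mul_of_nonneg_left ?_ (hτ0 _)
      have a1 := mul_le_mul_of_nonneg_left hEb ha0
      have a2 := mul_le_mul_of_nonneg_left hGb (show 0 ≤ K₀ / 2 by positivity)
      linarith
    have h2 : ‖∫ x, ⟪U n 0 x, ψ 0 x - FunctionSpaces.Torus.fourierTruncate (N n) (ψ 0) x⟫‖ ≤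
        τ (N n) * (K₀ * (2⁻¹ + 2⁻¹ * ∫ x, ‖u₀ x‖ ^ 2)) := by
      have ig : Integrable (fun x => ‖U n 0 x‖ * (K₀ * τ (N n))) volume :=
        hU0c.integrable_unitAddTorus.norm.mul_const _
      have h21 : ‖∫ x, ⟪U n 0 x, ψ 0 x - FunctionSpaces.Torus.fourierTruncate (N n) (ψ 0) x⟫‖ ≤
          (∫ x, ‖U n 0 x‖) * (K₀ * τ (N n)) := by
        refine (norm_integral_le_of_norm_le ig (ae_of_all _ fun x => ?_)).trans (le_of_eq ?_)
        · rw [Real.norm_eq_abs]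
          refine (abs_real_inner_le_norm _ _).trans (mul_le_mul_of_nonneg_left ?_ (norm_nonneg _))
          rw [hτdef]; exact hK₀ _ 0 ⟨le_rfl, hT.le⟩ x
        · rw [integral_mul_const]
      -- `∫ ‖U n 0‖ ≤ ½ + ½ ∫ ‖U n 0‖² ≤ ½ + ½ ∫ ‖u₀‖²`
      have h22 : ∫ x, ‖U n 0 x‖ ≤ 2⁻¹ + 2⁻¹ * ∫ x, ‖u₀ x‖ ^ 2 := by
        have i1 : Integrable (fun x => ‖U n 0 x‖) volume := hU0c.integrable_unitAddTorus.norm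
        have i2 : Integrable (fun x => ‖U n 0 x‖ ^ 2) volume := (hU0c.norm.pow 2).integrable_unitAddTorus
        have h3 : ∫ x, ‖U n 0 x‖ ≤ ∫ x, ((2⁻¹ : ℝ) + 2⁻¹ * ‖U n 0 x‖ ^ 2) := by
          refine integral_mono i1 ((integrable_const _).add (i2.const_mul _)) fun x => ?_
          dsimp only
          nlinarith [sq_nonneg (‖U n 0 x‖ - 1)]
        rw [integral_add (integrable_const _) (i2.const_mul _), integral_const_mul, integral_const] at h3
        simp only [Measure.real, measure_univ, ENNReal.toReal_one, one_smul] at h3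
        have h4 := hS.integral_norm_sq_zero_le n
        nlinarith [h3, h4]
      refine h21.trans ?_
      have hKτ : 0 ≤ K₀ * τ (N n) := mul_nonneg hK₀0 (hτ0 _)
      nlinarith [mul_le_mul_of_nonneg_right h22 hKτ]
    rw [← Real.norm_eq_abs]
    refine (norm_add_le _ _).trans ?_
    rw [hMcdef]
    nlinarith [h1, h2, hτ0 (N n)]
  -- conclusion: squeeze
  have hMc0 : Tendsto (fun n => τ (N n) * Mc) atTop (𝓝 0) := by
    simpa using hτlim.mul_const Mc
  exact squeeze_zero_norm (fun n => by rw [Real.norm_eq_abs]; exact hbound n) hMc0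

/-- **Weak `L²` convergence of the slices of a Hopf–Galerkin family at every time**
(Robinson–Rodrigo–Sadowski 2016, Thm. 4.4 Step 3, (4.12); port of
`IsHopfGalerkinScheme.tendsto_integral_inner_limit`, `NSHopfWeakConvergence`): if the
approximations converge coefficientwise at every `t ≥ 0` to a field `u` with `L²` slices, then
`∫⟪U n t, w⟫ → ∫⟪u t, w⟫` for every `w ∈ L²(T^d)` and every `t ≥ 0` (`ν ≥ 0`). [cite: RobinsonRodrigoSadowski2016, Thm. 4.4 Step 3 (4.12)] -/
theorem IsHopfGalerkinFamily.tendsto_integral_inner_limit (hS : IsHopfGalerkinFamily ν f u₀ N F U)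
    (hν : 0 ≤ ν) (hu₀ : MemLp u₀ 2 volume)
    (hfm : AEStronglyMeasurable (FunctionSpaces.Torus.stLift f) (volume.restrict (Set.Ioi 0 ×ˢ Set.univ)))
    (hf₂ : ∀ T, 0 < T → ∫⁻ t in Set.Ioo 0 T, ∫⁻ x, ‖f t x‖ₑ ^ 2 < ⊤)
    (hu : ∀ t, 0 ≤ t → MemLp (u t) 2 volume)
    (hc : ∀ t, 0 ≤ t → ∀ k, Tendsto (fun n => mFourierCoeff (FunctionSpaces.EuclideanSpace.complexify ∘ U n t) k)
      atTop (𝓝 (mFourierCoeff (FunctionSpaces.EuclideanSpace.complexify ∘ u t) k)))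
    {w : UnitAddTorus d → EuclideanSpace ℝ d} (hw : MemLp w 2 volume) {t : ℝ} (ht : 0 ≤ t) :
    Tendsto (fun n => ∫ x, ⟪U n t x, w x⟫) atTop (𝓝 (∫ x, ⟪u t x, w x⟫)) := by
  have hT' : 0 < t + 1 := by linarith
  obtain ⟨A, hA, hFA⟩ := hS.exists_force_bound hfm hf₂ hT'
  obtain ⟨Y, hYdef⟩ : ∃ Y : ℝ, Y = 2 * (∫ x, ‖u₀ x‖ ^ 2) + 4 * (t + 1) * A.toReal := ⟨_, rfl⟩
  have htI : t ∈ Set.Icc 0 (t + 1) := ⟨ht, by linarith⟩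
  have hYn : ∀ n, ∫ x, ‖U n t x‖ ^ 2 ≤ Y := fun n =>
    (hS.integral_norm_sq_le hν hT' hA n (hFA n) htI).trans (by
      have := hS.integral_norm_sq_zero_le n
      rw [hYdef]; linarith)
  have hYu : ∫ x, ‖u t x‖ ^ 2 ≤ Y := by
    rw [hYdef]; exact hS.integral_norm_sq_limit_le hν hu₀ hu hc hT' hA hFA htI
  have h := Torus.tendsto_integral_inner_of_tendsto_mFourierCoeff (a := w)
    (fun n => hS.memLp_slice n ht) (hu t ht) hw hYn hYu (hc t ht)
  have hcomm : ∀ v : UnitAddTorus d → EuclideanSpace ℝ d,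
      (∫ x, ⟪v x, w x⟫) = ∫ x, ⟪w x, v x⟫ := fun v =>
    integral_congr_ae (ae_of_all _ fun x => real_inner_comm _ _)
  simp_rw [hcomm]
  exact h

/-- **The weak form of the Navier–Stokes equations for the limit of a Hopf–Galerkin family**
(the fourth conjunct of `Torus.IsWeakNSSolutionForcedOn` with datum `u 0`; Robinson–Rodrigo–
Sadowski 2016, Thm. 4.4 Step 4, pp. 76–77; Constantin–Foias 1988, Ch. 8, Theorem (Leray); Hopf
1951, §4): for every divergence-free space–time test field `ψ` on `[0, T)`,
`∫₀ᵀ ∫ (⟪u, ∂ₜψ⟫ + ⟪u, (u·∇)ψ⟫ + ν⟪u, Δψ⟫ + ⟪f, ψ⟫) + ∫ ⟪u 0, ψ(0)⟫ = 0`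
(`E_n(ψ) → E(ψ)` by `tendsto_integral_sliceFunctional` and the weak convergence of the data,
`E_n(ψ) → 0` by `tendsto_weakFunctional`). [cite: RobinsonRodrigoSadowski2016, Thm. 4.4 Step 4] -/
theorem IsHopfGalerkinFamily.weak_form_limit (hS : IsHopfGalerkinFamily ν f u₀ N F U)
    (hν : 0 < ν) (hu₀ : MemLp u₀ 2 volume)
    (hfm : AEStronglyMeasurable (FunctionSpaces.Torus.stLift f) (volume.restrict (Set.Ioi 0 ×ˢ Set.univ)))
    (hf₂ : ∀ T, 0 < T → ∫⁻ t in Set.Ioo 0 T, ∫⁻ x, ‖f t x‖ₑ ^ 2 < ⊤)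
    (hum : AEStronglyMeasurable (FunctionSpaces.Torus.stLift u) (volume.restrict (Set.Ioi 0 ×ˢ Set.univ)))
    (hu : ∀ t, 0 ≤ t → MemLp (u t) 2 volume)
    (hc : ∀ t, 0 ≤ t → ∀ k, Tendsto (fun n => mFourierCoeff (FunctionSpaces.EuclideanSpace.complexify ∘ U n t) k)
      atTop (𝓝 (mFourierCoeff (FunctionSpaces.EuclideanSpace.complexify ∘ u t) k))) (hT : 0 < T)
    (hψ : FunctionSpaces.Torus.IsSpaceTimeTest T ψ) (hdiv : FunctionSpaces.Torus.IsDivFreeTest ψ) :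
    (∫ t in Set.Ioo 0 T, ∫ x, (⟪u t x, FunctionSpaces.Torus.timeDeriv ψ t x⟫ + ⟪u t x, FunctionSpaces.Torus.convect (u t) (ψ t) x⟫ +
        ν * ⟪u t x, FunctionSpaces.Torus.laplacian (ψ t) x⟫ + ⟪f t x, ψ t x⟫)) + ∫ x, ⟪u 0 x, ψ 0 x⟫ = 0 := by
  have h1 := (hS.tendsto_integral_sliceFunctional hν hu₀ hfm hf₂ hum hu hc hT hψ).add
    (hS.tendsto_integral_inner_limit hν.le hu₀ hfm hf₂ hu hc ((hψ.isSmooth_slice 0).memLp 2) le_rfl)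
  have h2 := hS.tendsto_weakFunctional hν.le hu₀ hfm hf₂ hT hψ hdiv
  exact tendsto_nhds_unique h1 h2

end WeakForm

end NS

end Literature.Analysis.FluidPDE

/-!
# Part 2 — assembly: the limit of a Hopf–Galerkin family is Leray–Hopf from `u 0`

Assembly of the passage to the limit for Hopf–Galerkin **families** (Robinson–Rodrigo–Sadowski
2016, Thm. 4.4 Steps 3–4, Thm. 4.6, Cor. 4.7, Thm. 4.11 and p. 82; Constantin–Foias 1988, Ch. 8,
Theorem (Leray); Hopf 1951, §4) from `NSGalerkinFamilyLimit`, `NSGalerkinFamilyEnergy`, Part 1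
of this module and `isLerayHopfOn_of_clauses` (`NSHopfGalerkin`). Main result:
`IsHopfGalerkinFamily.isLerayHopfOn_limit`.
-/

open MeasureTheory TopologicalSpace Set Function Filter Topology UnitAddTorus
open scoped InnerProductSpace RealInnerProductSpace ENNReal NNReal

namespace Literature.Analysis.FluidPDE

variable {d : Type*} [Fintype d] [DecidableEq d]

variable {ν : ℝ} {f : ℝ → UnitAddTorus d → EuclideanSpace ℝ d}
  {u₀ : UnitAddTorus d → EuclideanSpace ℝ d} {N : ℕ → ℕ}
  {F U : ℕ → ℝ → UnitAddTorus d → EuclideanSpace ℝ d}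
  {u : ℝ → UnitAddTorus d → EuclideanSpace ℝ d}

/-- **A coefficientwise limit of a Hopf–Galerkin family whose data converge strongly is a
Leray–Hopf weak solution on every `[0, T)` from the datum `u 0`** (Robinson–Rodrigo–Sadowski
2016, Thm. 4.4 Steps 3–4 with Thm. 4.6, Cor. 4.7 and the remark on abstract sequences, p. 82;
Constantin–Foias 1988, Ch. 8, Theorem (Leray)): the eight clauses of `Torus.IsLerayHopfOn` for a
field `u` with `L²` slices, a.e. strongly measurable on `(0, ∞) × T^d`, to which the
approximations converge coefficientwise at every time, with `‖U n 0 - u 0‖_{L²} → 0` (`ν > 0`).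
For a Hopf–Galerkin *scheme* and `u 0 = u₀` a.e. this is `IsHopfGalerkinScheme.isLerayHopfOn_limit`. [cite: RobinsonRodrigoSadowski2016, Thm. 4.4 Steps 3–4, Thm. 4.6, Thm. 4.11] -/
theorem IsHopfGalerkinFamily.isLerayHopfOn_limit (hS : IsHopfGalerkinFamily ν f u₀ N F U)
    (hν : 0 < ν) (hu₀ : MemLp u₀ 2 volume)
    (hfm : AEStronglyMeasurable (FunctionSpaces.Torus.stLift f) (volume.restrict (Set.Ioi 0 ×ˢ Set.univ)))
    (hf₂ : ∀ T, 0 < T → ∫⁻ t in Set.Ioo 0 T, ∫⁻ x, ‖f t x‖ₑ ^ 2 < ⊤)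
    (hum : AEStronglyMeasurable (FunctionSpaces.Torus.stLift u) (volume.restrict (Set.Ioi 0 ×ˢ Set.univ)))
    (hu : ∀ t, 0 ≤ t → MemLp (u t) 2 volume)
    (hc : ∀ t, 0 ≤ t → ∀ k, Tendsto (fun n => mFourierCoeff (FunctionSpaces.EuclideanSpace.complexify ∘ U n t) k)
      atTop (𝓝 (mFourierCoeff (FunctionSpaces.EuclideanSpace.complexify ∘ u t) k)))
    (h0 : Tendsto (fun n => eLpNorm (U n 0 - u 0) 2 volume) atTop (𝓝 0)) {T : ℝ} (hT : 0 < T) :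
    Torus.IsLerayHopfOn T ν f (u 0) u := by
  refine isLerayHopfOn_of_clauses hT hν.le (hu 0 le_rfl) ?_ ?_ (fun t ht => hu t ht.1) ?_ ?_ ?_ ?_
  · -- the forced weak form
    refine ⟨hum.mono_measure (Measure.restrict_mono (Set.prod_mono Set.Ioo_subset_Ioi_self subset_rfl) le_rfl),
      hS.lintegral_limit_lt_top hν.le hu₀ hfm hf₂ hu hc hT, ?_, fun ψ hψ hψdiv => ?_⟩
    · filter_upwards [ae_restrict_mem measurableSet_Ioo] with t ht
      exact hS.isWeaklyDivFree_limit hu hc ht.1.le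
    · exact hS.weak_form_limit hν hu₀ hfm hf₂ hum hu hc hT hψ hψdiv
  · exact hS.energy_bound_limit hν.le hu₀ hfm hf₂ hu hc hT
  · exact hS.memL2Sobolev_limit hν hu₀ hfm hf₂ hum hu hc hT
  · exact fun t ht => hS.energy_ineq_zero_limit hν hu₀ hfm hf₂ hum hu hc h0 hT ht
  · exact hS.energy_ineq_ae_limit hν hu₀ hfm hf₂ hum hu hc hT
  · intro w hw
    have hcont := hS.continuousOn_integral_inner_limit hν.le hu₀ hfm hf₂ hu hc hw
    refine ⟨hcont.mono fun t ht => Set.mem_Ici.2 ht.1.le, ?_⟩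
    exact ((hcont 0 (Set.mem_Ici.2 le_rfl)).tendsto).mono_left (nhdsWithin_mono _ Set.Ioi_subset_Ici_self)

/-- **Global version**: under the hypotheses of `isLerayHopfOn_limit` the limit is a global
Leray–Hopf weak solution from `u 0` (Leray–Hopf on `[0, T)` for every `T > 0`). [cite: RobinsonRodrigoSadowski2016, Thm. 4.4] -/
theorem IsHopfGalerkinFamily.isGlobalLerayHopf_limit (hS : IsHopfGalerkinFamily ν f u₀ N F U)
    (hν : 0 < ν) (hu₀ : MemLp u₀ 2 volume)
    (hfm : AEStronglyMeasurable (FunctionSpaces.Torus.stLift f) (volume.restrict (Set.Ioi 0 ×ˢ Set.univ)))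
    (hf₂ : ∀ T, 0 < T → ∫⁻ t in Set.Ioo 0 T, ∫⁻ x, ‖f t x‖ₑ ^ 2 < ⊤)
    (hum : AEStronglyMeasurable (FunctionSpaces.Torus.stLift u) (volume.restrict (Set.Ioi 0 ×ˢ Set.univ)))
    (hu : ∀ t, 0 ≤ t → MemLp (u t) 2 volume)
    (hc : ∀ t, 0 ≤ t → ∀ k, Tendsto (fun n => mFourierCoeff (FunctionSpaces.EuclideanSpace.complexify ∘ U n t) k)
      atTop (𝓝 (mFourierCoeff (FunctionSpaces.EuclideanSpace.complexify ∘ u t) k)))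
    (h0 : Tendsto (fun n => eLpNorm (U n 0 - u 0) 2 volume) atTop (𝓝 0)) :
    Torus.IsGlobalLerayHopf ν f (u 0) u :=
  fun _ hT => hS.isLerayHopfOn_limit hν hu₀ hfm hf₂ hum hu hc h0 hT

/-- **Strong `L²` convergence at almost every time along a subsequence** (Robinson–Rodrigo–Sadowski
2016, proof of Thm. 4.6: from `U n → u` in `L²((0,T) × T^d)` a subsequence converges in `L²(T^d)`
for a.e. `t ∈ (0, T)`): for a coefficientwise limit `u` of a Hopf–Galerkin family (`ν > 0`) there
is a strictly increasing `φ` with `‖U (φ j) s - u s‖_{L²} → 0` for a.e. `s ∈ (0, T)`.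
[cite: RobinsonRodrigoSadowski2016, Thm. 4.6 (proof)] -/
theorem IsHopfGalerkinFamily.exists_strictMono_ae_tendsto_eLpNorm (hS : IsHopfGalerkinFamily ν f u₀ N F U)
    (hν : 0 < ν) (hu₀ : MemLp u₀ 2 volume)
    (hfm : AEStronglyMeasurable (FunctionSpaces.Torus.stLift f) (volume.restrict (Set.Ioi 0 ×ˢ Set.univ)))
    (hf₂ : ∀ T, 0 < T → ∫⁻ t in Set.Ioo 0 T, ∫⁻ x, ‖f t x‖ₑ ^ 2 < ⊤)
    (hum : AEStronglyMeasurable (FunctionSpaces.Torus.stLift u) (volume.restrict (Set.Ioi 0 ×ˢ Set.univ)))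
    (hu : ∀ t, 0 ≤ t → MemLp (u t) 2 volume)
    (hc : ∀ t, 0 ≤ t → ∀ k, Tendsto (fun n => mFourierCoeff (FunctionSpaces.EuclideanSpace.complexify ∘ U n t) k)
      atTop (𝓝 (mFourierCoeff (FunctionSpaces.EuclideanSpace.complexify ∘ u t) k))) {T : ℝ} (hT : 0 < T) :
    ∃ φ : ℕ → ℕ, StrictMono φ ∧ ∀ᵐ s ∂(volume.restrict (Set.Ioo 0 T)),
      Tendsto (fun j => eLpNorm (U (φ j) s - u s) 2 volume) atTop (𝓝 0) := by
  have hZ := hS.tendsto_lintegral_enorm_sub_sq hν hu₀ hfm hf₂ hum hu hc hT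
  -- a fast subsequence
  have hev : ∀ j : ℕ, ∃ M, ∀ n ≥ M,
      ∫⁻ τ in Set.Ioo 0 T, ∫⁻ x, ‖U n τ x - u τ x‖ₑ ^ 2 ≤ (2⁻¹ : ℝ≥0∞) ^ j := fun j =>
    eventually_atTop.1 (ENNReal.tendsto_nhds_zero.1 hZ _ (ENNReal.pow_pos (by norm_num) j))
  obtain ⟨φ, hφ, hφb⟩ := extraction_forall_of_eventually' hev
  have hGm : ∀ j, AEMeasurable (fun τ => ∫⁻ x, ‖U (φ j) τ x - u τ x‖ₑ ^ 2)
      (volume.restrict (Set.Ioo 0 T)) := fun j =>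
    Torus.aemeasurable_lintegral_enorm_sub_sq (hS.aestronglyMeasurable_stLift (φ j)) hum T
  have htsum : ∫⁻ τ in Set.Ioo 0 T, ∑' j, ∫⁻ x, ‖U (φ j) τ x - u τ x‖ₑ ^ 2 ≠ ⊤ := by
    rw [lintegral_tsum hGm]
    refine ne_top_of_le_ne_top ?_ (ENNReal.tsum_le_tsum hφb)
    rw [ENNReal.tsum_geometric, ENNReal.one_sub_inv_two, inv_inv]
    exact ENNReal.ofNat_ne_top
  refine ⟨φ, hφ, ?_⟩
  filter_upwards [ae_lt_top' (AEMeasurable.tsum hGm) htsum] with s hs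
  have hs' : Tendsto (fun j => ∫⁻ x, ‖U (φ j) s x - u s x‖ₑ ^ 2) atTop (𝓝 0) :=
    ENNReal.tendsto_atTop_zero_of_tsum_ne_top hs.ne
  have h := ((ENNReal.continuous_rpow_const (y := 1 / 2)).tendsto 0).comp hs'
  rw [ENNReal.zero_rpow_of_pos (by norm_num)] at h
  refine h.congr fun j => ?_
  simp only [Function.comp_apply, Torus.eLpNorm_two_eq_rpow, Pi.sub_apply]

end Literature.Analysis.FluidPDE
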